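import Literature.Analysis.FluidPDE.BoundedMildSmoothRemainder
import Literature.Analysis.FluidPDE.NSBoundedMildSmoothing
import Summits.NavierStokesRegularity.NavierStokesRegularity.Theses.CertifiedBlowup
import HarnessLib

/-!
# Uniform space–time Lipschitz modulus of bounded Oseen-mild fields on a window, up to the final time
# (registered stub `zoom_window_lipschitz` of the crux `CertifiedBlowupAxisymBlowup`)

Theorems file landed `--supports stmt-NavierStokesRegularity-0727` (crux `CertifiedBlowupAxisymBlowup`), registered stub
`zoom_window_lipschitz` of the sub-skeleton "axis-aware KNSS sup-zoom of a witness"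
(`Cruxes/CertifiedBlowupAxisymBlowup/Lines/registered_zoom_probe.lean`), stated VERBATIM as registered: there is ONE constant
`L ≥ 0` such that every field `V`, continuous on `(A, B) × ℝ³` (`A ≤ −3`, `B > 0`), bounded by `2` on `(A, 0] × ℝ³`, weakly
divergence-free, and satisfying the Oseen integral identity between all times `A < s < t ≤ 0`, obeys
`‖V(t, x) − V(s, y)‖ ≤ L(|t − s| + ‖x − y‖)` for all `s, t ∈ [−1, 0]`, `x, y` — the equicontinuity that lets the zoom of a
blow-up sequence be compared across nearby slices and centres. PROOF from the tree's DISCHARGED KNSS 2009 §4 regularity of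
bounded mild solutions with constants chosen before the solution (`KNSS2009_mild_regularity_holds`, (4.10)–(4.11)): the
shifted field `U(τ) = V(τ − 2)` on `[0, 2]` is a restarted bounded mild field (`isKNSSDriftMild_clamp_of_oseenForward`,
`oseenDuhamel_translate`), so on `τ ∈ (1/2, 2)` (i.e. `t ∈ (−3/2, 0)`) its gradient is bounded by `C 1 (1/2)` and its slices
are `L 0 (1/2)`-Lipschitz in time; the mean value inequality gives the spatial part; the endpoint `t = 0` (excluded from
the open window) is reached by continuity of `V` at `(0, x)` (`B > 0`). No new definitions, no named-fact hypotheses, no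
`sorry`; the local notation `ℝ³` is the registered signature's own. WHAT THIS IS NOT: not a statement about blow-up —
regularity bookkeeping for GIVEN bounded mild fields. Cell `ns-blowup`, zone Z1 (profile-eng-1 g9).

## References
* H. Koch, N. Nadirashvili, G. Seregin, V. Šverák, Acta Math. 203 (2009), §4 (4.10)–(4.11). [KochNadirashviliSereginSverak2009]
-/

set_option linter.dupNamespace false

noncomputable section

open MeasureTheory Set Function Filter Topology Metric
open scoped NNReal ENNReal

namespace Summit.NavierStokesRegularity.NavierStokesRegularity.Theorems.CertifiedBlowupAxisymBlowup.CompactAmplification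

open Literature.Analysis Literature.Analysis.FluidPDE Literature.Analysis.UnboundedOperators
open Summit.NavierStokesRegularity.NavierStokesRegularity.Theses.CertifiedBlowup

local notation "ℝ³" => EuclideanSpace ℝ (Fin 3)

/-- `‖D⁰f(x) − D⁰g(x)‖ = ‖f x − g x‖`. [folklore] -/
theorem norm_iteratedFDeriv_zero_sub (f g : ℝ³ → ℝ³) (x : ℝ³) :
    ‖iteratedFDeriv ℝ 0 f x - iteratedFDeriv ℝ 0 g x‖ = ‖f x - g x‖ := by
  have h : iteratedFDeriv ℝ 0 f x - iteratedFDeriv ℝ 0 g x = iteratedFDeriv ℝ 0 (fun y => f y - g y) x := by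
    ext m
    simp [iteratedFDeriv_zero_apply]
  rw [h, norm_iteratedFDeriv_zero]

/-- `‖D¹f(x)‖ = ‖Df(x)‖`. [folklore] -/
theorem norm_iteratedFDeriv_one_eq_norm_fderiv (f : ℝ³ → ℝ³) (x : ℝ³) :
    ‖iteratedFDeriv ℝ 1 f x‖ = ‖fderiv ℝ f x‖ := by
  rw [← norm_iteratedFDeriv_fderiv, norm_iteratedFDeriv_zero]

/-- **Open-window form**: the registered Lipschitz bound for `s, t ∈ [−1, 0)` (the open KNSS window), with the constant
`K` built from `KNSS2009_mild_regularity_holds 2 2`. [cite: KochNadirashviliSereginSverak2009, §4 (4.10)–(4.11)] -/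
theorem zoom_window_lipschitz_Ico : ∃ L : ℝ, 0 ≤ L ∧ ∀ (V : ℝ → ℝ³ → ℝ³) (A B : ℝ), A ≤ -3 → 0 < B →
    ContinuousOn (uncurry V) (Ioo A B ×ˢ univ) → (∀ s ∈ Ioc A 0, ∀ y, ‖V s y‖ ≤ 2) →
    (∀ s ∈ Ioo A B, IsWeaklyDivFree (V s)) →
    (∀ s t : ℝ, A < s → s < t → t ≤ 0 → ∀ x, V t x = heatExtension (V s) (t - s) x - oseenDuhamel 1 s V V t x) →
    ∀ s ∈ Ico (-1 : ℝ) 0, ∀ t ∈ Ico (-1 : ℝ) 0, ∀ x y : ℝ³, ‖V t x - V s y‖ ≤ L * (|t - s| + ‖x - y‖) := by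
  obtain ⟨C, L, hCL⟩ := KNSS2009_mild_regularity_holds 2 2 two_pos
  set K : ℝ := max (max (C 1 (1 / 2)) (L 0 (1 / 2))) 0 with hK
  have hK0 : 0 ≤ K := le_max_right _ _
  have hKC : C 1 (1 / 2) ≤ K := (le_max_left _ _).trans (le_max_left _ _)
  have hKL : L 0 (1 / 2) ≤ K := (le_max_right _ _).trans (le_max_left _ _)
  refine ⟨K, hK0, fun V A B hA hB hcont hbd hdiv hmild s hs t ht x y => ?_⟩
  -- ### the shifted field on `[0, 2]`
  set U : ℝ → ℝ³ → ℝ³ := fun τ => V (τ + -2) with hU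
  have hIcc : ∀ τ ∈ Icc (0 : ℝ) 2, τ + -2 ∈ Ioo A B := fun τ hτ => ⟨by linarith [hτ.1], by linarith [hτ.2]⟩
  have hcontU : ContinuousOn (uncurry U) (Icc 0 2 ×ˢ univ) := by
    have hmap : Continuous fun q : ℝ × ℝ³ => (q.1 + -2, q.2) := (continuous_fst.add continuous_const).prodMk continuous_snd
    refine (hcont.comp hmap.continuousOn fun q hq => ⟨hIcc q.1 (mem_prod.1 hq).1, mem_univ _⟩).congr fun q _ => ?_
    rfl
  have hKU : ∀ τ ∈ Icc (0 : ℝ) 2, ∀ z, ‖U τ z‖ ≤ 2 := fun τ hτ z =>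
    hbd (τ + -2) ⟨by linarith [hτ.1], by linarith [hτ.2]⟩ z
  have hdivU : ∀ τ ∈ Icc (0 : ℝ) 2, IsWeaklyDivFree (U τ) := fun τ hτ => hdiv (τ + -2) (hIcc τ hτ)
  have hmildU : ∀ σ τ : ℝ, 0 ≤ σ → σ < τ → τ ≤ 2 → ∀ z,
      U τ z = heatExtension (U σ) (τ - σ) z - oseenDuhamel 1 σ U U τ z := by
    intro σ τ hσ hστ hτ z
    have h := hmild (σ + -2) (τ + -2) (by linarith) (by linarith) (by linarith) z
    rw [show τ + -2 - (σ + -2) = τ - σ by ring] at h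
    rw [hU, oseenDuhamel_translate]
    exact h
  have hV := isKNSSDriftMild_clamp_of_oseenForward two_pos hcontU hKU hdivU hmildU
  obtain ⟨hsm, -, hgrad, hlip, -⟩ := hCL hV
  -- ### the window times `τ = t + 2`, `σ = s + 2` lie in `(1/2, 2)`, where the clamp is `V(· − 2)`
  have hτ : t + 2 ∈ Ioo (1 / 2 : ℝ) 2 := ⟨by linarith [ht.1], by linarith [ht.2]⟩
  have hσ : s + 2 ∈ Ioo (1 / 2 : ℝ) 2 := ⟨by linarith [hs.1], by linarith [hs.2]⟩
  have hcl : ∀ r ∈ Ioo (1 / 2 : ℝ) 2, (fun z => U (max 0 (min r 2)) z) = V (r + -2) := fun r hr => by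
    funext z
    rw [min_eq_left hr.2.le, max_eq_right (by linarith [hr.1])]
  have hτt : t + 2 + -2 = t := by ring
  have hσs : s + 2 + -2 = s := by ring
  -- ### space: gradient bound ⇒ Lipschitz in `x` at time `t`
  have hD : ∀ z, ‖fderiv ℝ (V t) z‖ ≤ K := fun z => by
    have h := hgrad (1 / 2) (by norm_num) 1 (t + 2) hτ z
    rw [hcl (t + 2) hτ, hτt, norm_iteratedFDeriv_one_eq_norm_fderiv] at h
    exact h.trans hKC
  have hdiff : ∀ z ∈ (univ : Set ℝ³), DifferentiableAt ℝ (V t) z := fun z _ => by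
    have h := hsm (t + 2) ⟨by linarith [hτ.1], hτ.2⟩
    rw [hcl (t + 2) hτ, hτt] at h
    exact (h.differentiable (by simp)).differentiableAt
  have hx : ‖V t x - V t y‖ ≤ K * ‖x - y‖ :=
    Convex.norm_image_sub_le_of_norm_fderiv_le hdiff (fun z _ => hD z) convex_univ (mem_univ y) (mem_univ x)
  -- ### time: Lipschitz in `t` at the point `y`
  have hty : ‖V t y - V s y‖ ≤ K * |t - s| := by
    have h := hlip (1 / 2) (by norm_num) 0 (s + 2) hσ (t + 2) hτ y
    rw [hcl (t + 2) hτ, hcl (s + 2) hσ, hτt, hσs, norm_iteratedFDeriv_zero_sub,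
      show t + 2 - (s + 2) = t - s by ring] at h
    exact h.trans (mul_le_mul_of_nonneg_right hKL (abs_nonneg _))
  calc ‖V t x - V s y‖ = ‖(V t x - V t y) + (V t y - V s y)‖ := by rw [sub_add_sub_cancel]
    _ ≤ ‖V t x - V t y‖ + ‖V t y - V s y‖ := norm_add_le _ _
    _ ≤ K * ‖x - y‖ + K * |t - s| := add_le_add hx hty
    _ = K * (|t - s| + ‖x - y‖) := by ring

/-- **Registered stub `zoom_window_lipschitz`**: the uniform space–time Lipschitz modulus on `[−1, 0]² × ℝ³ × ℝ³`, INCLUDING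
the final time `0` (reached by continuity of `V` at `(0, ·)`, `B > 0`). [cite: KochNadirashviliSereginSverak2009, §4 (4.10)–(4.11)] -/
theorem zoom_window_lipschitz : ∃ L : ℝ, 0 ≤ L ∧ ∀ (V : ℝ → ℝ³ → ℝ³) (A B : ℝ), A ≤ -3 → 0 < B → ContinuousOn (uncurry V) (Ioo A B ×ˢ univ) → (∀ s ∈ Ioc A 0, ∀ y, ‖V s y‖ ≤ 2) → (∀ s ∈ Ioo A B, IsWeaklyDivFree (V s)) → (∀ s t : ℝ, A < s → s < t → t ≤ 0 → ∀ x, V t x = UnboundedOperators.heatExtension (V s) (t - s) x - oseenDuhamel 1 s V V t x) → ∀ s ∈ Icc (-1 : ℝ) 0, ∀ t ∈ Icc (-1 : ℝ) 0, ∀ x y : ℝ³, ‖V t x - V s y‖ ≤ L * (|t - s| + ‖x - y‖) := by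
  obtain ⟨K, hK0, H⟩ := zoom_window_lipschitz_Ico
  refine ⟨K, hK0, fun V A B hA hB hcont hbd hdiv hmild s hs t ht x y => ?_⟩
  -- approach `(s, t)` from inside the open window: `s_ε = (1 − ε)s − ε`, `t_ε = (1 − ε)t − ε`, `ε → 0⁺`
  have hin : ∀ {r : ℝ}, r ∈ Icc (-1 : ℝ) 0 → ∀ {ε : ℝ}, 0 < ε → ε < 1 → (1 - ε) * r - ε ∈ Ico (-1 : ℝ) 0 := by
    intro r hr ε hε hε1
    constructor <;> nlinarith [hr.1, hr.2]
  have hcontr : ∀ {r : ℝ}, r ∈ Icc (-1 : ℝ) 0 → ∀ z : ℝ³,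
      Tendsto (fun ε : ℝ => V ((1 - ε) * r - ε) z) (𝓝[>] 0) (𝓝 (V r z)) := by
    intro r hr z
    have hr0 : r ∈ Ioo A B := ⟨by linarith [hr.1], lt_of_le_of_lt hr.2 hB⟩
    have h1 : ContinuousWithinAt (uncurry V) (Ioo A B ×ˢ univ) (r, z) := hcont _ ⟨hr0, mem_univ _⟩
    have h2 : Tendsto (fun ε : ℝ => ((1 - ε) * r - ε, z)) (𝓝[>] 0) (𝓝[Ioo A B ×ˢ univ] (r, z)) := by
      apply tendsto_nhdsWithin_of_tendsto_nhds_of_eventually_within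
      · have hc : Continuous fun ε : ℝ => ((1 - ε) * r - ε, z) := by fun_prop
        have h := hc.tendsto 0
        simp only [sub_zero, one_mul] at h
        exact h.mono_left nhdsWithin_le_nhds
      · filter_upwards [Ioo_mem_nhdsGT (zero_lt_one' ℝ)] with ε hε
        have h := hin hr hε.1 hε.2
        exact ⟨⟨by linarith [h.1], lt_of_lt_of_le h.2 hB.le⟩, mem_univ _⟩
    exact h1.tendsto.comp h2
  have hlim : Tendsto (fun ε : ℝ => ‖V ((1 - ε) * t - ε) x - V ((1 - ε) * s - ε) y‖) (𝓝[>] 0)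
      (𝓝 ‖V t x - V s y‖) := ((hcontr ht x).sub (hcontr hs y)).norm
  have hrhs : Tendsto (fun ε : ℝ => K * (|((1 - ε) * t - ε) - ((1 - ε) * s - ε)| + ‖x - y‖)) (𝓝[>] 0)
      (𝓝 (K * (|t - s| + ‖x - y‖))) := by
    have hc : Continuous fun ε : ℝ => K * (|((1 - ε) * t - ε) - ((1 - ε) * s - ε)| + ‖x - y‖) := by fun_prop
    have h := hc.tendsto 0
    simp only [sub_zero, one_mul] at h
    exact h.mono_left nhdsWithin_le_nhds
  refine le_of_tendsto_of_tendsto hlim hrhs ?_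
  filter_upwards [Ioo_mem_nhdsGT (zero_lt_one' ℝ)] with ε hε
  exact H V A B hA hB hcont hbd hdiv hmild _ (hin hs hε.1 hε.2) _ (hin ht hε.1 hε.2) x y

end Summit.NavierStokesRegularity.NavierStokesRegularity.Theorems.CertifiedBlowupAxisymBlowup.CompactAmplification
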